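import Summits.MatrixMultiplication.OmegaCensus.ThreeSetZ4Z4Orders2080
import HarnessLib

/-!
# A list-indexed factorisation criterion for the `ℤ₄²`-quotient column

ω-census `pub-omega`, family (b3), seat pub-omega-group gen 17.  Framing: lottery ticket; floor = certified bounds/negative
ranges.  VALUE: assembly infrastructure for the kernel classification (TPP capacity of dihedral-like groups); NOT progress on ω.

`no_mod_one_law_of_onto_z4z4_of_pairs L`: for a dihedral-like group over `A ↠ ℤ₄ × ℤ₄` (`|A| ≥ 14`), if for every pair
`(p, q) ∈ L` the cell form 'balanced coset parts with a part `p` and another part `q` ⇒ no law' holds in this group, and every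
factorisation `cde = (|A|−1)/3` has a part `1` or two parts `{p, q}` for some `(p, q) ∈ L`, then no TPP triple attains
`3|S||T||U| + 8 = 8|A|`.  This replaces the hand-written disjunctions of `no_mod_one_law_of_onto_z4z4_threeset / _nine`: a
new table `(p, q)` only needs its cell-form theorem and a `decide`d factorisation check with the longer list.
`cells_of_mem_pairs17`: the hypothesis for the gen-14/17 list `[(3,3),(3,5),(5,5),(7,7),(3,7),(3,9),(5,7),(5,9)]`.
Assembly template (not restated here, it would duplicate `no_mod_one_law_of_onto_z4z4_card_lt_2080`): apply
`no_mod_one_law_of_onto_z4z4_of_pairs L … (cells_of_mem_pairsNN …) hq h` with `hq` obtained from a `decide`d factorisation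
table whose conclusion is `(c = 1 ∨ d = 1 ∨ e = 1) ∨ ∃ pq ∈ L, …` (decide handles the bounded `∃`).
-/

namespace Summit.MatrixMultiplication.OmegaCensus

open Finset

section DihedralLike

variable {A : Type} [AddCommGroup A] [DecidableEq A] [Fintype A] {G : Type} [Group G] [DecidableEq G]
  {ρ τ : A → G} {c₀ : A} {S T U : Finset G}

open Literature.Combinatorics.Additive

/-- **List-indexed criterion.** [folklore] -/
theorem no_mod_one_law_of_onto_z4z4_of_pairs (L : List (ℕ × ℕ))
    (hρρ : ∀ a b, ρ a * ρ b = ρ (a + b)) (hρτ : ∀ a b, ρ a * τ b = τ (b - a))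
    (hτρ : ∀ a b, τ a * ρ b = τ (a + b)) (hττ : ∀ a b, τ a * τ b = ρ (c₀ + b - a))
    (hρ : Function.Injective ρ) (hτ : Function.Injective τ) (hne : ∀ a b, ρ a ≠ τ b)
    (hsurj : ∀ g, (∃ a, ρ a = g) ∨ (∃ a, τ a = g)) (hA : 14 ≤ Fintype.card A)
    (φ : A →+ ZMod 4 × ZMod 4) (hφ : Function.Surjective φ)
    (hL : ∀ pq ∈ L, ∀ S T U : Finset G, TripleProductProperty S T U →
      (univ.filter fun a : A => ρ a ∈ S).card = (univ.filter fun a : A => τ a ∈ S).card →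
      (univ.filter fun a : A => ρ a ∈ T).card = (univ.filter fun a : A => τ a ∈ T).card →
      (univ.filter fun a : A => ρ a ∈ U).card = (univ.filter fun a : A => τ a ∈ U).card →
      (((univ.filter fun a : A => ρ a ∈ S).card = pq.1 ∧ (univ.filter fun a : A => ρ a ∈ T).card = pq.2) ∨
        ((univ.filter fun a : A => ρ a ∈ T).card = pq.1 ∧ (univ.filter fun a : A => ρ a ∈ U).card = pq.2) ∨
        ((univ.filter fun a : A => ρ a ∈ U).card = pq.1 ∧ (univ.filter fun a : A => ρ a ∈ S).card = pq.2) ∨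
        ((univ.filter fun a : A => ρ a ∈ S).card = pq.2 ∧ (univ.filter fun a : A => ρ a ∈ T).card = pq.1) ∨
        ((univ.filter fun a : A => ρ a ∈ T).card = pq.2 ∧ (univ.filter fun a : A => ρ a ∈ U).card = pq.1) ∨
        ((univ.filter fun a : A => ρ a ∈ U).card = pq.2 ∧ (univ.filter fun a : A => ρ a ∈ S).card = pq.1)) →
      3 * (S.card * T.card * U.card) + 8 ≠ 8 * Fintype.card A)
    (hq : ∀ c d e : ℕ, 3 * (c * d * e) + 1 = Fintype.card A → (c = 1 ∨ d = 1 ∨ e = 1) ∨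
      ∃ pq ∈ L, ((c = pq.1 ∧ d = pq.2) ∨ (d = pq.1 ∧ e = pq.2) ∨ (e = pq.1 ∧ c = pq.2) ∨
        (c = pq.2 ∧ d = pq.1) ∨ (d = pq.2 ∧ e = pq.1) ∨ (e = pq.2 ∧ c = pq.1)))
    (h : TripleProductProperty S T U) : 3 * (S.card * T.card * U.card) + 8 ≠ 8 * Fintype.card A := by
  intro hV
  have hmod : Fintype.card A % 3 = 1 := by omega
  by_cases hnc : ((univ.filter fun a : A => ρ a ∈ S).card = (univ.filter fun a : A => τ a ∈ S).card ∧
      (univ.filter fun a : A => ρ a ∈ T).card = (univ.filter fun a : A => τ a ∈ T).card ∧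
      (univ.filter fun a : A => ρ a ∈ U).card = (univ.filter fun a : A => τ a ∈ U).card)
  · obtain ⟨hS', hT', hU'⟩ := hnc
    have cS := card_eq_parts' hρ hτ hne hsurj S
    have cT := card_eq_parts' hρ hτ hne hsurj T
    have cU := card_eq_parts' hρ hτ hne hsurj U
    set s₀ := (univ.filter fun a : A => ρ a ∈ S).card with hs₀
    set t₀ := (univ.filter fun a : A => ρ a ∈ T).card with ht₀
    set u₀ := (univ.filter fun a : A => ρ a ∈ U).card with hu₀
    have eS : S.card = 2 * s₀ := by rw [cS, ← hS']; ring
    have eT : T.card = 2 * t₀ := by rw [cT, ← hT']; ring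
    have eU : U.card = 2 * u₀ := by rw [cU, ← hU']; ring
    have hprod : 3 * (s₀ * t₀ * u₀) + 1 = Fintype.card A := by
      rw [eS, eT, eU] at hV; nlinarith
    rcases hq s₀ t₀ u₀ hprod with h1 | ⟨pq, hpq, hcases⟩
    · exact no_law_cube_one_of_onto_z4z4 hρρ hρτ hτρ hττ hρ hτ hne hsurj φ hφ h hS' hT' hU' h1 hV
    · exact hL pq hpq S T U h hS' hT' hU' hcases hV
  · obtain ⟨g, a, b, hab⟩ :=
      two_cosets_of_mod_one_law_of_not_cube hρρ hρτ hτρ hττ hρ hτ hne hsurj hmod hA h hV hnc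
    exact not_two_cosets_of_onto_z4z4 φ hφ g a b hab

/-- **Cell form `(3,3,·)`** in the six-way format (from gen 14's `no_law_cube_33e_of_onto_z4z4`). [folklore] -/
theorem no_law_cube_three_three_six_of_onto_z4z4
    (hρρ : ∀ a b, ρ a * ρ b = ρ (a + b)) (hρτ : ∀ a b, ρ a * τ b = τ (b - a))
    (hτρ : ∀ a b, τ a * ρ b = τ (a + b)) (hττ : ∀ a b, τ a * τ b = ρ (c₀ + b - a))
    (hρ : Function.Injective ρ) (hτ : Function.Injective τ) (hne : ∀ a b, ρ a ≠ τ b)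
    (hsurj : ∀ g, (∃ a, ρ a = g) ∨ (∃ a, τ a = g))
    (Φ : A →+ ZMod 4 × ZMod 4) (hΦ : Function.Surjective Φ)
    (h : TripleProductProperty S T U)
    (hS : (univ.filter fun a : A => ρ a ∈ S).card = (univ.filter fun a : A => τ a ∈ S).card)
    (hT : (univ.filter fun a : A => ρ a ∈ T).card = (univ.filter fun a : A => τ a ∈ T).card)
    (hU : (univ.filter fun a : A => ρ a ∈ U).card = (univ.filter fun a : A => τ a ∈ U).card)
    (h33 : (((univ.filter fun a : A => ρ a ∈ S).card = 3 ∧ (univ.filter fun a : A => ρ a ∈ T).card = 3) ∨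
        ((univ.filter fun a : A => ρ a ∈ T).card = 3 ∧ (univ.filter fun a : A => ρ a ∈ U).card = 3) ∨
        ((univ.filter fun a : A => ρ a ∈ U).card = 3 ∧ (univ.filter fun a : A => ρ a ∈ S).card = 3) ∨
        ((univ.filter fun a : A => ρ a ∈ S).card = 3 ∧ (univ.filter fun a : A => ρ a ∈ T).card = 3) ∨
        ((univ.filter fun a : A => ρ a ∈ T).card = 3 ∧ (univ.filter fun a : A => ρ a ∈ U).card = 3) ∨
        ((univ.filter fun a : A => ρ a ∈ U).card = 3 ∧ (univ.filter fun a : A => ρ a ∈ S).card = 3))) :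
    3 * (S.card * T.card * U.card) + 8 ≠ 8 * Fintype.card A :=
  no_law_cube_two_parts_of_ordered 3 3
    (fun h' hS₀ hS₁ hT₀ hT₁ hU' hV => no_law_cube_33e_of_onto_z4z4 hρρ hρτ hτρ hττ hρ hτ hne hsurj Φ hΦ h'
      hS₀ hS₁ hT₀ hT₁ hU' hV) h hS hT hU h33

/-- **The gen-14/17 list**: every pair of `[(3,3),(3,5),(5,5),(7,7),(3,7),(3,9),(5,7),(5,9)]` has its cell form over any
dihedral-like group with `A ↠ ℤ₄ × ℤ₄`. [folklore] -/
theorem cells_of_mem_pairs17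
    (hρρ : ∀ a b, ρ a * ρ b = ρ (a + b)) (hρτ : ∀ a b, ρ a * τ b = τ (b - a))
    (hτρ : ∀ a b, τ a * ρ b = τ (a + b)) (hττ : ∀ a b, τ a * τ b = ρ (c₀ + b - a))
    (hρ : Function.Injective ρ) (hτ : Function.Injective τ) (hne : ∀ a b, ρ a ≠ τ b)
    (hsurj : ∀ g, (∃ a, ρ a = g) ∨ (∃ a, τ a = g))
    (Φ : A →+ ZMod 4 × ZMod 4) (hΦ : Function.Surjective Φ) :
    ∀ pq ∈ ([(3,3), (3,5), (5,5), (7,7), (3,7), (3,9), (5,7), (5,9)] : List (ℕ × ℕ)), ∀ S T U : Finset G,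
      TripleProductProperty S T U →
      (univ.filter fun a : A => ρ a ∈ S).card = (univ.filter fun a : A => τ a ∈ S).card →
      (univ.filter fun a : A => ρ a ∈ T).card = (univ.filter fun a : A => τ a ∈ T).card →
      (univ.filter fun a : A => ρ a ∈ U).card = (univ.filter fun a : A => τ a ∈ U).card →
      (((univ.filter fun a : A => ρ a ∈ S).card = pq.1 ∧ (univ.filter fun a : A => ρ a ∈ T).card = pq.2) ∨
        ((univ.filter fun a : A => ρ a ∈ T).card = pq.1 ∧ (univ.filter fun a : A => ρ a ∈ U).card = pq.2) ∨
        ((univ.filter fun a : A => ρ a ∈ U).card = pq.1 ∧ (univ.filter fun a : A => ρ a ∈ S).card = pq.2) ∨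
        ((univ.filter fun a : A => ρ a ∈ S).card = pq.2 ∧ (univ.filter fun a : A => ρ a ∈ T).card = pq.1) ∨
        ((univ.filter fun a : A => ρ a ∈ T).card = pq.2 ∧ (univ.filter fun a : A => ρ a ∈ U).card = pq.1) ∨
        ((univ.filter fun a : A => ρ a ∈ U).card = pq.2 ∧ (univ.filter fun a : A => ρ a ∈ S).card = pq.1)) →
      3 * (S.card * T.card * U.card) + 8 ≠ 8 * Fintype.card A := by
  intro pq hpq S T U h hS hT hU hpq'
  simp only [List.mem_cons, List.not_mem_nil, or_false] at hpq
  rcases hpq with rfl | rfl | rfl | rfl | rfl | rfl | rfl | rfl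
  · exact no_law_cube_three_three_six_of_onto_z4z4 hρρ hρτ hτρ hττ hρ hτ hne hsurj Φ hΦ h hS hT hU hpq'
  · exact no_law_cube_three_five_of_onto_z4z4 hρρ hρτ hτρ hττ hρ hτ hne hsurj Φ hΦ h hS hT hU hpq'
  · exact no_law_cube_two_parts_of_ordered 5 5
      (fun h' hS₀ hS₁ hT₀ hT₁ hU' hV => no_law_cube_55e_of_onto_z4z4 hρρ hρτ hτρ hττ hρ hτ hne hsurj Φ hΦ h'
        hS₀ hS₁ hT₀ hT₁ hU' hV) h hS hT hU hpq'
  · exact no_law_cube_two_parts_of_ordered 7 7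
      (fun h' hS₀ hS₁ hT₀ hT₁ hU' hV => no_law_cube_77e_of_onto_z4z4 hρρ hρτ hτρ hττ hρ hτ hne hsurj Φ hΦ h'
        hS₀ hS₁ hT₀ hT₁ hU' hV) h hS hT hU hpq'
  · exact no_law_cube_three_seven_of_onto_z4z4 hρρ hρτ hτρ hττ hρ hτ hne hsurj Φ hΦ h hS hT hU hpq'
  · exact no_law_cube_three_nine_of_onto_z4z4 hρρ hρτ hτρ hττ hρ hτ hne hsurj Φ hΦ h hS hT hU hpq'
  · exact no_law_cube_five_seven_of_onto_z4z4 hρρ hρτ hτρ hττ hρ hτ hne hsurj Φ hΦ h hS hT hU hpq'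
  · exact no_law_cube_five_nine_of_onto_z4z4 hρρ hρτ hτρ hττ hρ hτ hne hsurj Φ hΦ h hS hT hU hpq'

end DihedralLike

end Summit.MatrixMultiplication.OmegaCensus
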